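import Summits.BirchSwinnertonDyer.BirchSwinnertonDyer.Theorems.SchneiderFreeAdditiveX3GordTwoBranchIMCBROfTree
import Summits.BirchSwinnertonDyer.BirchSwinnertonDyer.Theorems.SchneiderFreeAdditiveX3GordCellPerPairNoKY24
import HarnessLib

/-!
# Route `SchneiderFreeAdditiveX3` (K1 door): the PER-PAIR records at `p = 3` and at every odd prime — lower half, both halves from the twist-unit datum, Miller's
# `BSD(E, p)` — WITHOUT the named fact [BR3] `KellerYin2024.thm122_charLambda_pair_three` (re-keyed onto Bleher et al. 3.3.1 / de Shalit II.6.4 / Hida Thm I,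
# which both halves already display), without any Keller–Yin 2402.12781 statement, no Greenberg, no duality binder (FILE 5 of generation 42's [BR3] re-key; twins of F47h)

Cell `bsd-schneider-ideate`, seat `bsd-schneider-door-c5` (prover, generation 42; assembly layer; `--supports` 19177).  PARTITION: board row
B6 ∩ X3 ∩ sst-twist, `r = 1`, the WHOLE (G-ord, `e = 2`) half (2 560 of 7 101 census pairs: 2 411 at `p = 3`, 149 at `p ≥ 5`) of `Rank1Residual.partition`
— ASSEMBLY; types-the-object-of nothing new; RE-KEYS F47h `KYBranchPerPairNoKY24` §1/§3 off `hBR`: lower half at `3` from FILE 4's crux currency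
(`KYBranchBROfTree.additiveIMCLowerBDPInputManinAt_gordTwo_three`, 13 named) through generation 36's per-pair bridge; upper half at `3` unchanged (F47g never consumed
[BR3]); `p ≥ 5` unchanged (F45 §2); closes none of B6's cells (BSD NOT advanced).  bears_on: K1-door (19177 r3; per-pair statements of the rung leaf and of `BSDp`).
* §1 `p = 3`: `missingLowerBoundAt_gordTwo_three`, `missingPPartAt_gordTwo_three_of_twistUnitAt`, `bsdp_gordTwo_three_of_twistUnitAt`.
* §2 every odd `p`: `missingLowerBoundAt_gordTwo`, `missingPPartAt_gordTwo_of_twistUnitAt`, `bsdp_gordTwo_of_twistUnitAt`.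
INPUT LEDGER per pair after this file — lower half: `PrintedFacts` ∪ {Hsieh A, LZZ, Castella–Hsieh signed} ∪ {[DIV.dvd] PRE; [AN3] (both forms), [AN-BR₅] PRE; CGLS Thm
2.1.2} ∪ {CGLS Prop 1.2.5 (module clause), Cor 1.2.6 ×2; Bleher et al. 3.3.1; de Shalit II.6.4; Hida Thm I}; both halves add the pair's twist-unit datum
`Upper.TwistUnitFieldOffSliverAt W p` (census: a kit certificate per pair; class-wide: wing r2, OPEN).  [BR3] GONE; NOTHING from arXiv:2402.12781 on either half.
HONEST FRAMING: compositions of tree theorems, CONDITIONAL BY NAME on the displayed statements; `BSDp W p` here is BSD_p MODULO those statements and the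
pair's TU datum — NOT a proof of BSD for any curve; no definition, no named fact, no `sorry`; nothing is closed; «closes rung: none».  References:
[KellerYin2024b] Thm. 3.3.6, Prop. 3.4.4, §3.5, Thm. 3.5.1, Lemma 2.3.8; [CastellaGrossiLeeSkinner2022] Thms. 1.2.2, 2.1.2, 2.2.2, Props. 1.2.5, 14, Cor. 1.2.6;
[BleherEtAl2020] Thm. 3.3.1; [deShalit1987] II.6.4; [Hida2010MuInvariant] Thm. I; [MilneADT2006] I Thm. 4.10 (a); [Miller2011LMS] Def. 1.1; [JetchevSkinnerWan2017]
§7.4.1; [FriedbergHoffstein1995] Thm. B; [GrossZagier1986] I.(6.3), (7.3); this seat p758065 (F42), p759994 (F45), p762470 (F47h), FILES 1–4 (gen 42).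
-/

set_option autoImplicit false
set_option linter.dupNamespace false -- the summit namespace `…BirchSwinnertonDyer.BirchSwinnertonDyer.Theorems` (Sub = Summit, D-0017) trips it

noncomputable section

open scoped Classical NumberField

open Field NumberField IsDedekindDomain WeierstrassCurve PowerSeries
  Literature.NumberTheory.EllipticCurves Literature.NumberTheory.EllipticCurves.GreenbergSelmer
  Literature.NumberTheory.GaloisRepresentations Literature.NumberTheory.GaloisCohomology
  Literature.NumberTheory.EllipticCurves.ModularForms Literature.NumberTheory.EllipticCurves.Rank1Residual
  Literature.NumberTheory.EllipticCurves.Rank1Residual.Typed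
  Literature.NumberTheory.EllipticCurves.KellerYin2024 Literature.NumberTheory.EllipticCurves.CaiShuTian2014
  Literature.NumberTheory.IwasawaTheory Literature.NumberTheory.IwasawaTheory.Greenberg2016
  Literature.NumberTheory.IwasawaTheory.Greenberg2006
  Literature.NumberTheory.EllipticCurves.Rubin1991 Literature.NumberTheory.EllipticCurves.DeShalit1987
  Literature.NumberTheory.EllipticCurves.Hida2010MuInvariant Literature.NumberTheory.EllipticCurves.BCGKPST2020
  Summit.BirchSwinnertonDyer.Rank1Residual Summit.BirchSwinnertonDyer.Rank1Residual.X11b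
  Summit.BirchSwinnertonDyer.Rank1Residual.X11b.AcSelmer Summit.BirchSwinnertonDyer.Rank1Residual.X11b.Halves
  Summit.BirchSwinnertonDyer.Rank1Residual.Additive Summit.BirchSwinnertonDyer.Rank1Residual.GaloisImage
  Summit.BirchSwinnertonDyer.BirchSwinnertonDyer.Theorems
  Summit.BirchSwinnertonDyer.BirchSwinnertonDyer.Theorems.EisensteinPrimesMuLambda
  Summit.BirchSwinnertonDyer.BirchSwinnertonDyer.Theorems.SchneiderFree
  Summit.BirchSwinnertonDyer.BirchSwinnertonDyer.Theorems.SchneiderFree.Upper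
  Summit.BirchSwinnertonDyer.BirchSwinnertonDyer.Theorems.SchneiderFree.KYRead
  Summit.BirchSwinnertonDyer.BirchSwinnertonDyer.Theses.SchneiderFreeAdditiveX3
  Summit.BirchSwinnertonDyer.BirchSwinnertonDyer.Theorems.SchneiderFreeAdditiveX3
open Literature.NumberTheory.EllipticCurves.CastellaGrossiLeeSkinner2022
  (prop14_residualCharacterSelmer_finite thm212_exists_isKatzLFunction prop125_characterGrSelmerDual_torsion_muZero_dim prop125_characterGrSelmerDual_corank_ge
    cor126_residualCharacter_globalLift cor126_residualCharacter_localSurjective)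
open Literature.NumberTheory.EllipticCurves.KellerYin2024 (thm122_rubinHida_residualPair_unrSelmer prop125_residualPair_unrSelmer_imprimitive
  thm351_anacong_branch_three_allTwists thm351_anacong_charLambda_branch_five_le)
open Summit.BirchSwinnertonDyer.BirchSwinnertonDyer.Theorems.PoitouTateShaNaturalAtTC
  (forall_poitouTate_shaRestricted_tateDual_natural_at_of_isTotallyComplex)
open Summit.BirchSwinnertonDyer.BirchSwinnertonDyer.Theorems.TeichmullerPairUnramifiedAtMult (prop14_residualCharacterSelmer_finite_of_fact)

namespace Summit.BirchSwinnertonDyer.BirchSwinnertonDyer.Theorems.SchneiderFreeAdditiveX3.KYBranchPerPairBROfTree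


/-! ### §1 `p = 3`: the per-pair records on the whole (G-ord, `e = 2`) cell — no Greenberg, no duality binder, no [BR3] -/

/-- **LOWER half per pair on the WHOLE (G-ord, `e = 2`) cell AT `p = 3`, no per-pair hypothesis, no Greenberg input, no duality binder, no Keller–Yin 2402.12781 statement, no [BR3]:** for every globally
minimal `W/ℚ` with `r_an = 1`, `ClassX3 W 3`, `SubGordTwo W 3`: `MissingLowerBoundAt W 3` (`ord₃ #Ш(E)_an ≤ ord₃ #Ш(E)`) — generation 42 FILE 4's crux currency at `3` (Bleher et al. 3.3.1, de Shalit II.6.4,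
Hida Thm I in place of [RH] AND of [BR3]; [PWL-θ] a tree theorem) through generation 36's per-pair bridge `KrizLiLeafThirtySeven.missingLowerBoundAt_of_printedFacts_of_imcLowerInputAt`.  CONDITIONAL on the displayed named
statements; closes no item; BSD not advanced. [claim: KellerYin2024PotOrd, status: under-review]
[cite: KellerYin2024b, Thm. 3.3.6, Prop. 3.4.4, Thm. 3.5.1 (arXiv:2410.23241 pp. 19–20) (preprint; hypotheses)]
[cite: CastellaGrossiLeeSkinner2022, Thms. 1.2.2, 2.1.2, 2.2.2, Props. 1.2.5, 14, Cor. 1.2.6] [cite: KellerYin2024, Thms. 1.2.2, 1.4.1, Prop. 1.2.5 (arXiv:2402.12781v2)]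
[cite: MilneADT2006, I Thm. 4.10 (a)] [cite: JetchevSkinnerWan2017, §7.4.1 (arXiv:1512.06894 p. 30)] -/
theorem missingLowerBoundAt_gordTwo_three (hF : PrintedFacts)
    (hA : Hsieh2014.thmA_exists_isHsiehLFunction_unrPeriod_anyLevel)
    (hL : LiuZhangZhang2018.thm151_thm153_modularCurve_heegnerVector_additive)
    (hCHσ : castellaHsieh2018_exists_isBranchBDPLFunction_signed)
    (hDVD : thm336_dvd_branch_OPEN) (hAN3 : thm351_anacong_branch_three) (hAN : thm351_anacong_branch_three_allTwists)
    (h212 : thm212_exists_isKatzLFunction)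
    (hprop125 : prop125_characterGrSelmerDual_torsion_muZero_dim)
    (hlift : cor126_residualCharacter_globalLift) (hlocal : cor126_residualCharacter_localSurjective)
    (h331 : thm331_rubin_exists_katzMeasure₂_pseudoIso_span_eq)
    (hFE : thmII64_katzMeasure₂_functionalEquation) (hO1 : thmI_mu_katzBranch_reflect_eq_zero) :
    ∀ (W : WeierstrassCurve ℚ) [W.IsElliptic] [W.IsGloballyMinimal],
      W.analyticRank = 1 → ClassX3 W 3 → Additive.SubGordTwo W 3 → MissingLowerBoundAt W 3 :=
  fun W _ _ hr hX hG =>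
    KrizLiLeafThirtySeven.missingLowerBoundAt_of_printedFacts_of_imcLowerInputAt hF W 3 hr (by decide) hX (Or.inr hG)
      (KYBranchBROfTree.additiveIMCLowerBDPInputManinAt_gordTwo_three hF.2.1 hF.2.2.2.2.1 hA hL hCHσ hDVD hAN3 hAN
        h212 hprop125 hlift hlocal h331 hFE hO1 W hr hX hG)

/-- **BOTH halves per pair on the whole (G-ord, `e = 2`) cell AT `p = 3` from the TU datum: `MissingPPartAt W 3`, no Greenberg input, no duality binder** — F42's
record with its Milne binder fed by the tree theorem.  CONDITIONAL; closes no item; BSD not advanced. [claim: KellerYin2024PotOrd, status: under-review]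
[cite: Miller2011LMS, Def. 1.1] [cite: KellerYin2024b, Thm. 3.3.6 and Prop. 3.4.4 (arXiv:2410.23241 p. 19) (preprint; hypothesis)]
[cite: CastellaGrossiLeeSkinner2022, Thms. 1.2.2, 2.1.2, 2.2.2, Prop. 14] -/
theorem missingPPartAt_gordTwo_three_of_twistUnitAt (hF : PrintedFacts)
    (hA : Hsieh2014.thmA_exists_isHsiehLFunction_unrPeriod_anyLevel)
    (hL : LiuZhangZhang2018.thm151_thm153_modularCurve_heegnerVector_additive)
    (hCHσ : castellaHsieh2018_exists_isBranchBDPLFunction_signed)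
    (hDVD : thm336_dvd_branch_OPEN) (hAN3 : thm351_anacong_branch_three) (hAN : thm351_anacong_branch_three_allTwists)
    (h212 : thm212_exists_isKatzLFunction)
    (hprop125 : prop125_characterGrSelmerDual_torsion_muZero_dim)
    (hlift : cor126_residualCharacter_globalLift) (hlocal : cor126_residualCharacter_localSurjective)
    (h331 : thm331_rubin_exists_katzMeasure₂_pseudoIso_span_eq)
    (hFE : thmII64_katzMeasure₂_functionalEquation) (hO1 : thmI_mu_katzBranch_reflect_eq_zero) :
    ∀ (W : WeierstrassCurve ℚ) [W.IsElliptic] [W.IsGloballyMinimal],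
      W.analyticRank = 1 → ClassX3 W 3 → Additive.SubGordTwo W 3 → Upper.TwistUnitFieldOffSliverAt W 3 → MissingPPartAt W 3 :=
  fun W _ _ hr hX hG hTU =>
    missingPPartAt_of_lower_of_upper W 3
      (missingLowerBoundAt_gordTwo_three hF hA hL hCHσ hDVD hAN3 hAN h212 hprop125 hlift hlocal h331 hFE hO1 W hr hX hG)
      (UpperThreeAnomalousOfPartnerClassTree.missingUpperBoundAt_gordTwo_three_of_printedFacts_of_twistUnitAt_of_tree hF hA hL hDVD
        (prop14_residualCharacterSelmer_finite_of_fact hprop125) hCHσ h331 hFE hO1 W hr hX hG hTU)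

/-- **Miller's `BSD(E, 3)` per pair on the WHOLE (G-ord, `e = 2`) cell from the TU datum, no Greenberg input, no duality binder** — F42's record with its Milne
binder fed by the tree theorem.  NOT a proof of BSD for any curve: BSD₃ MODULO {published theorems} ∪ {[DIV.dvd] (preprint), the analytic counts, [RH], [PWL-θ]}
∪ {the pair's TU certificate}. [claim: KellerYin2024PotOrd, status: under-review] [cite: Miller2011LMS, §1 and Def. 1.1]
[cite: KellerYin2024b, Thm. 3.3.6 and Prop. 3.4.4 (arXiv:2410.23241 p. 19) (preprint; hypothesis)] -/
theorem bsdp_gordTwo_three_of_twistUnitAt (hF : PrintedFacts)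
    (hA : Hsieh2014.thmA_exists_isHsiehLFunction_unrPeriod_anyLevel)
    (hL : LiuZhangZhang2018.thm151_thm153_modularCurve_heegnerVector_additive)
    (hCHσ : castellaHsieh2018_exists_isBranchBDPLFunction_signed)
    (hDVD : thm336_dvd_branch_OPEN) (hAN3 : thm351_anacong_branch_three) (hAN : thm351_anacong_branch_three_allTwists)
    (h212 : thm212_exists_isKatzLFunction)
    (hprop125 : prop125_characterGrSelmerDual_torsion_muZero_dim)
    (hlift : cor126_residualCharacter_globalLift) (hlocal : cor126_residualCharacter_localSurjective)
    (h331 : thm331_rubin_exists_katzMeasure₂_pseudoIso_span_eq)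
    (hFE : thmII64_katzMeasure₂_functionalEquation) (hO1 : thmI_mu_katzBranch_reflect_eq_zero) :
    ∀ (W : WeierstrassCurve ℚ) [W.IsElliptic] [W.IsGloballyMinimal],
      W.analyticRank = 1 → ClassX3 W 3 → Additive.SubGordTwo W 3 → Upper.TwistUnitFieldOffSliverAt W 3 → BSDp W 3 :=
  fun W _ _ hr hX hG hTU =>
    bsdp_of_missingPPartAt W 3 hF.2.2.1 (le_of_eq hr)
      (missingPPartAt_gordTwo_three_of_twistUnitAt hF hA hL hCHσ hDVD hAN3 hAN h212 hprop125 hlift hlocal h331 hFE hO1 W hr hX hG hTU)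

/-! ### §2 The WHOLE (G-ord, `e = 2`) half at EVERY odd prime — no Greenberg, no duality binder, no [BR3] -/

/-- **The LOWER half `ord_p #Ш(E)_an ≤ ord_p #Ш(E)` PER PAIR on the WHOLE (G-ord, `e = 2`) half of B6 ∩ X3 at EVERY odd prime `p`, NO per-pair hypothesis,
no Greenberg input, no duality binder** — F42's record with its Milne binder fed by the tree theorem.  INPUT LEDGER: `PrintedFacts` ∪ {Hsieh A, LZZ, Castella–Hsieh
signed} ∪ {[DIV.dvd] PRE; [AN3], [AN-BR₅] PRE; CGLS Thm 2.1.2} ∪ {CGLS Prop 1.2.5 (module clause), Cor 1.2.6 ×2; Bleher et al. 3.3.1; Katz II.6.4;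
Hida Thm I} — every one refereed print or a Keller–Yin preprint clause.  CONDITIONAL on every displayed hypothesis; closes no item; BSD not advanced
beyond this typed reduction. [claim: KellerYin2024PotOrd, status: under-review]
[cite: KellerYin2024b, Thm. 3.3.6, Prop. 3.4.4, §3.5, Thm. 3.5.1 and Lemma 2.3.8 (arXiv:2410.23241 pp. 11, 19–20) (preprint; hypotheses)]
[cite: CastellaGrossiLeeSkinner2022, Thms. 1.2.2, 2.1.2, 2.2.2, Props. 1.2.5, 14, Cor. 1.2.6] [cite: KellerYin2024, Thms. 1.2.2, 2.2.2 (arXiv:2402.12781v2)]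
[cite: MilneADT2006, I Thm. 4.10 (a)] [cite: JetchevSkinnerWan2017, §7.4.1] [cite: FriedbergHoffstein1995, Thm. B] -/
theorem missingLowerBoundAt_gordTwo (hF : PrintedFacts)
    (hA : Hsieh2014.thmA_exists_isHsiehLFunction_unrPeriod_anyLevel)
    (hL : LiuZhangZhang2018.thm151_thm153_modularCurve_heegnerVector_additive)
    (hCHσ : castellaHsieh2018_exists_isBranchBDPLFunction_signed)
    (hDVD : thm336_dvd_branch_OPEN)
    (hAN3 : thm351_anacong_branch_three_allTwists) (h212 : thm212_exists_isKatzLFunction)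
    (hAN5 : thm351_anacong_charLambda_branch_five_le)
    (hprop125 : prop125_characterGrSelmerDual_torsion_muZero_dim)
    (hlift : cor126_residualCharacter_globalLift) (hlocal : cor126_residualCharacter_localSurjective)
    (h331 : thm331_rubin_exists_katzMeasure₂_pseudoIso_span_eq)
    (hFE : thmII64_katzMeasure₂_functionalEquation) (hO1 : thmI_mu_katzBranch_reflect_eq_zero) :
    ∀ (W : WeierstrassCurve ℚ) [W.IsElliptic] [W.IsGloballyMinimal] (p : ℕ) [Fact p.Prime],
      W.analyticRank = 1 → p ≠ 2 → ClassX3 W p → Additive.SubGordTwo W p → MissingLowerBoundAt W p := by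
  intro W _ _ p _ hr hp2 hX hG
  have hp : p.Prime := Fact.out
  obtain rfl | hp5 : p = 3 ∨ 5 ≤ p := by
    rcases Nat.lt_or_ge p 5 with h | h
    · left
      have h2 := hp.two_le
      interval_cases p
      · exact absurd rfl hp2
      · rfl
      · exact absurd hp (by norm_num)
    · exact Or.inr h
  · exact missingLowerBoundAt_gordTwo_three hF hA hL hCHσ hDVD hAN3.to_branch_three hAN3 h212 hprop125 hlift hlocal h331 hFE hO1 W hr hX hG
  · exact KYBranchPerPairOfTree.missingLowerBoundAt_gordTwo_five_le hF hA hL hCHσ hDVD hAN5 hprop125 hlift hlocal W p hp5 hr hX hG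

/-- **BOTH halves per pair on the WHOLE (G-ord, `e = 2`) half at EVERY odd prime from the TU datum: `MissingPPartAt W p`, no Greenberg input, no duality binder**
— F42's record with its Milne binder fed by the tree theorem.  CONDITIONAL; closes no item; BSD not advanced beyond this typed reduction.
[claim: KellerYin2024PotOrd, status: under-review] [cite: Miller2011LMS, Def. 1.1] [cite: KellerYin2024b, Thm. 3.3.6, Prop. 3.4.4, §3.5 (arXiv:2410.23241 pp. 19–20) (preprint; hypotheses)] -/
theorem missingPPartAt_gordTwo_of_twistUnitAt (hF : PrintedFacts)
    (hA : Hsieh2014.thmA_exists_isHsiehLFunction_unrPeriod_anyLevel)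
    (hL : LiuZhangZhang2018.thm151_thm153_modularCurve_heegnerVector_additive)
    (hCHσ : castellaHsieh2018_exists_isBranchBDPLFunction_signed)
    (hDVD : thm336_dvd_branch_OPEN)
    (hAN3 : thm351_anacong_branch_three_allTwists) (h212 : thm212_exists_isKatzLFunction)
    (hAN5 : thm351_anacong_charLambda_branch_five_le)
    (hprop125 : prop125_characterGrSelmerDual_torsion_muZero_dim)
    (hlift : cor126_residualCharacter_globalLift) (hlocal : cor126_residualCharacter_localSurjective)
    (h331 : thm331_rubin_exists_katzMeasure₂_pseudoIso_span_eq)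
    (hFE : thmII64_katzMeasure₂_functionalEquation) (hO1 : thmI_mu_katzBranch_reflect_eq_zero) :
    ∀ (W : WeierstrassCurve ℚ) [W.IsElliptic] [W.IsGloballyMinimal] (p : ℕ) [Fact p.Prime],
      W.analyticRank = 1 → p ≠ 2 → ClassX3 W p → Additive.SubGordTwo W p → Upper.TwistUnitFieldOffSliverAt W p → MissingPPartAt W p := by
  intro W _ _ p _ hr hp2 hX hG hTU
  have hp : p.Prime := Fact.out
  obtain rfl | hp5 : p = 3 ∨ 5 ≤ p := by
    rcases Nat.lt_or_ge p 5 with h | h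
    · left
      have h2 := hp.two_le
      interval_cases p
      · exact absurd rfl hp2
      · rfl
      · exact absurd hp (by norm_num)
    · exact Or.inr h
  · exact missingPPartAt_gordTwo_three_of_twistUnitAt hF hA hL hCHσ hDVD hAN3.to_branch_three hAN3 h212 hprop125 hlift hlocal h331 hFE hO1 W hr
      hX hG hTU
  · exact KYBranchPerPairOfTree.missingPPartAt_gordTwo_five_le_of_twistUnitAt hF hA hL hCHσ hDVD hAN5 hprop125 hlift hlocal W p hp5 hr hX hG hTU

/-- **Miller's `BSD(E, p)` per pair on the WHOLE (G-ord, `e = 2`) half at EVERY odd prime from the TU datum, no Greenberg input, no duality binder** — F42's record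
with its Milne binder fed by the tree theorem.  NOT a proof of BSD for any curve: BSD_p MODULO {published theorems} ∪ {[DIV.dvd], the typed analytic sentences,
[RH], [PWL-θ]} ∪ {the pair's TU certificate}. [claim: KellerYin2024PotOrd, status: under-review] [cite: Miller2011LMS, §1 and Def. 1.1]
[cite: KellerYin2024b, Thm. 3.3.6, Prop. 3.4.4, §3.5 (arXiv:2410.23241 pp. 19–20) (preprint; hypotheses)] -/
theorem bsdp_gordTwo_of_twistUnitAt (hF : PrintedFacts)
    (hA : Hsieh2014.thmA_exists_isHsiehLFunction_unrPeriod_anyLevel)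
    (hL : LiuZhangZhang2018.thm151_thm153_modularCurve_heegnerVector_additive)
    (hCHσ : castellaHsieh2018_exists_isBranchBDPLFunction_signed)
    (hDVD : thm336_dvd_branch_OPEN)
    (hAN3 : thm351_anacong_branch_three_allTwists) (h212 : thm212_exists_isKatzLFunction)
    (hAN5 : thm351_anacong_charLambda_branch_five_le)
    (hprop125 : prop125_characterGrSelmerDual_torsion_muZero_dim)
    (hlift : cor126_residualCharacter_globalLift) (hlocal : cor126_residualCharacter_localSurjective)
    (h331 : thm331_rubin_exists_katzMeasure₂_pseudoIso_span_eq)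
    (hFE : thmII64_katzMeasure₂_functionalEquation) (hO1 : thmI_mu_katzBranch_reflect_eq_zero) :
    ∀ (W : WeierstrassCurve ℚ) [W.IsElliptic] [W.IsGloballyMinimal] (p : ℕ) [Fact p.Prime],
      W.analyticRank = 1 → p ≠ 2 → ClassX3 W p → Additive.SubGordTwo W p → Upper.TwistUnitFieldOffSliverAt W p → BSDp W p :=
  fun W _ _ p _ hr hp2 hX hG hTU =>
    bsdp_of_missingPPartAt W p hF.2.2.1 (le_of_eq hr)
      (missingPPartAt_gordTwo_of_twistUnitAt hF hA hL hCHσ hDVD hAN3 h212 hAN5 hprop125 hlift hlocal h331 hFE hO1 W p hr hp2 hX hG hTU)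

end Summit.BirchSwinnertonDyer.BirchSwinnertonDyer.Theorems.SchneiderFreeAdditiveX3.KYBranchPerPairBROfTree

end
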